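import Literature.Computability.Cryptography.KitaevPhaseEstimationCircuit
import Literature.Computability.Cryptography.KitaevPhaseReconstruction
import Literature.Computability.Cryptography.ShorOrderFindingAnalysis
import Literature.Computability.Cryptography.QuantumCircuitProofs
import Literature.Computability.Cryptography.QubitRegisterCliffordTProofs
import HarnessLib

/-!
# Shor's order-finding theorem, quantum half: Kitaev's experiment, its analysis, and the assembly

Family `PQC` (trunk `CryptoQuantFine`); fifth companion of
`Literature/Computability/Cryptography/Shor.lean`. Target: the named fact
`Literature.Computability.Cryptography.Shor1997_orderFinding_isQSolvable` (`ShorProofs.lean`) — order finding is solvable in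
bounded-error quantum polynomial time over the tree's model (poly-time uniform oracle-free
Clifford+T families measured on all wires, `IsQSolvable`). Shor's transform `A_q`, `q = 2^l ≥ 16`,
is not an exact circuit over `{H, S, T, CNOT}` (Giles–Selinger 2013, Thm. 1), so the exact route
formalised here is Kitaev's (1995, §3): Hadamard tests of the controlled powers `U^{2^l}` of the
multiplication-by-`x` permutation, whose eigenvalues on the cyclic orbit of `1` are `e^{2πi s/r}`,
`r = ord_n(x)`. This file fixes the experiment, proves its analysis end to end, and assembles
the theorem from three named infrastructure facts:

* **Parameters and layout** (`numTrials = 4`, `numLevels ℓ = 2ℓ+1`, `blockSize ℓ = 6144(2ℓ+1)`,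
  `qOf ℓ = 4^ℓ`, `numControls`, `layout`, `trialOf`/`levelOf`/`typeOf`, `block`, `card_block`):
  four independent trials; in trial `t`, for every level `l ≤ 2ℓ`, `blockSize ℓ` cosine tests
  and as many sine tests of `U^{2^l}`, all controls in parallel around one clean classical block
  (the circuit `kitaevCircuit` of `KitaevPhaseEstimationCircuit`).
* **Post-processing** (`cnt`, `levelEst`, `phaseEst`, `orderEst`, `readControls`,
  `orderFindingPost`): per block count the `1`s; the signs of `1 - 2cnt/B` pick a quadrant
  centre for `2^l φ_t` (`quadrantCenter`); halving refinement over `ℚ` (`refined`,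
  `KitaevPhaseReconstruction`); nearest fraction with denominator `< n`
  (`Shor1997.candidate`, `ShorOrderFindingAnalysis`); `lcm` over the four trials.
* **Correctness on accurate read-outs** (`Accurate`, `Good`, `cdist_levelEst_le`,
  `cdist_phaseEst_le`, `candidate_phaseEst_eq`, `lcm_div_gcd_eq`, `orderEst_eq`): if every
  block count is within `B/16` of its mean under the hidden sample `s ∈ (ℤ/r)^4` and the `s_t`
  have no common divisor `≥ 2` with `r`, then the estimates are within `1/8`, each `2^l φ_t` is
  localised within `5/32`, `φ_t = s_t/r` within `(5/32)/4^ℓ ≤ 1/2q`, the candidates are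
  `r / gcd(s_t, r)` and their `lcm` is `r` (Kitaev 1995, §3, Lemma 10 and Thm. 1; §4).
* **Probability** (`card_not_good_le`, `card_good_ge`: bad samples `≤ ∑_{d∣r, d≥2} (r/d)⁴ ≤ r⁴/8`;
  `sum_not_accurate_le`, `sum_accurate_ge`: Chebyshev per block (`chebyshev_block`,
  `KitaevPhaseEstimationSums`) and a union bound, failure `≤ 8(2ℓ+1) · 64/B = 1/12`;
  `kitaev_success`: with the read-out law `kitaevCircuit_distribution` the favourable read-outs
  have Born probability `≥ (7/8)(11/12) = 77/96`), and the Born-rule plumbing to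
  `QCircuitFamily.kernelProb` (`toReal_outputPMF_map_toOuterMeasure`, `sum_tri_le_sum_ite`,
  `kernelProb_orderFindingPost_ge`).
* **Named facts** (not discharged here; infrastructure): `Kitaev1995_orderFindingFamily` — the
  Kitaev family around a *clean reversible modular-exponentiation block* exists and is poly-time
  uniform (Shor 1997, §3; Kitaev 1995, §2.2 Lemma 1 and §4 p. 15; needs the tree's pending
  TM-to-reversible-circuit compiler, cf. `Literature.Computability.QuantumComplexity.uniformReversibleSimulation`);
  `orderFindingPost_mem_FP` — the post-processor is polynomial time (programming fact).
* **Assembly**: `Shor1997_orderFinding_isQSolvable_of : isQSolvable_classicalWrap →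
  Kitaev1995_orderFindingFamily → orderFindingPost_mem_FP → Shor1997_orderFinding_isQSolvable`.

## References

* P. W. Shor, *Polynomial-time algorithms for prime factorization and discrete logarithms on a
  quantum computer*, SIAM J. Comput. 26 (1997) 1484–1509 (= arXiv:quant-ph/9508027v2), §3
  (reversible modular exponentiation), §5 (order finding; "this fraction can be found in
  polynomial time by using a continued fraction expansion"; Knill's `lcm` remark on p. 15).
* A. Yu. Kitaev, *Quantum measurements and the Abelian Stabilizer Problem*,
  arXiv:quant-ph/9511026 (1995): §1 p. 5 (factoring: "the stabilizer of `1` with respect to `F_g`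
  gives the order of an element `g`"), §2.2 Lemma 1 (garbage-free `(u,0,0) ↦ (u,F(u),0)`), §3
  Remark 8, Lemma 8, the estimate before Lemma 9, Lemma 10, Theorem 1 (pp. 13–14), §4 (p. 15:
  `P(h) = q⁻¹ ∑_{h'} P(h', h)`; random elements generate unless in a common maximal proper
  subgroup; uniformity of the procedure).
* B. Giles, P. Selinger, *Exact synthesis of multiqubit Clifford+T circuits*, Phys. Rev. A 87
  (2013) 032332, Thm. 1.
* E. Bernstein, U. Vazirani, *Quantum complexity theory*, SIAM J. Comput. 26 (1997), §8.

## Tree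

`IsQSolvable`, `QCircuitFamily.kernelProb`/`kernel`/`IsUniform` (`ClassBQP`, `QuantumCircuit`),
`QCircuit.outputPMF_apply_holds` (`QuantumCircuitProofs`), `cliffordT_isUnitary_holds`
(`QubitRegisterCliffordTProofs`), `encodeOrderInstance`, `natPairEncoding`,
`isQSolvable_classicalWrap`, `IsQSolvable.mono`, `Shor1997_orderFinding_isQSolvable`
(`ShorProofs`), `Shor1997.candidate`, `candidate_eq`, `orderOf_pos_and_lt`
(`ShorOrderFindingAnalysis`), `cdist`, `refined`, `cdist_refined_le`, `quadrantCenter`,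
`cdist_quadrantCenter_le_rat`, `exists_cdist_eq` (`KitaevPhaseReconstruction`), `kitaevCircuit`,
`kitaevCircuit_distribution`, `tri`, `testWeight`, `trialExp`, `testAngle`
(`KitaevPhaseEstimationCircuit`), `chebyshev_block`, `sum_prodWeight`
(`KitaevPhaseEstimationSums`), `coinInput`, `coinWire`, `val_coinWire` (`BQPProofs`),
`PolyTimeComputable.id` (`TimeBounds`), `bitsToNat_lt`, `length_boolPair` (`BoolEncodings`).
-/


noncomputable section

namespace Literature.Computability.Cryptography

namespace Kitaev1995

open _root_.Computability Complexity QuantumComplexity Matrix Finset Real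

/-! ### Parameters of the experiment (functions of the input length `ℓ`) -/

/-- Number of independent trials (eigenvalue samples `s_t`); four samples generate `ℤ/r`
with probability `≥ 7/8` (cf. Kitaev 1995, §4: `l` random elements fail to generate only if
they lie in a common maximal proper subgroup). [cite: Kitaev1995, §4] -/
def numTrials : ℕ := 4

/-- Number of levels: the powers `U^{2^l}`, `l < 2ℓ + 1`, are tested (Kitaev 1995, Thm. 1:
precision `2^{-2n-1}` for denominators `≤ 2^n`; here `n < 2^ℓ`). [cite: Kitaev1995, §3 Thm 1] -/
def numLevels (ℓ : ℕ) : ℕ := 2 * ℓ + 1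

/-- Number of repetitions of each Hadamard test (cosine and sine, per trial and level); chosen
so that Chebyshev's inequality bounds the total failure probability of the `2 · 4 · (2ℓ+1)`
estimates by `1/12`. [cite: Kitaev1995, §3 (before Lemma 9)] -/
def blockSize (ℓ : ℕ) : ℕ := 6144 * numLevels ℓ

/-- The precision modulus `q = 4^ℓ ≥ n²` of the continued-fraction step. [cite: Shor1997, §5] -/
def qOf (ℓ : ℕ) : ℕ := 2 ^ (2 * ℓ)

/-- Number of control wires: one per test. [folklore] -/
def numControls (ℓ : ℕ) : ℕ := numTrials * (numLevels ℓ * (2 * blockSize ℓ))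

/-- Test labels `(trial, level, type, repetition)`; type `false` = cosine test, `true` = sine
test. [folklore] -/
abbrev TestLabel (ℓ : ℕ) := Fin numTrials × Fin (numLevels ℓ) × Bool × Fin (blockSize ℓ)

/-- Block labels `(trial, level, type)`. [folklore] -/
abbrev Blk (ℓ : ℕ) := Fin numTrials × Fin (numLevels ℓ) × Bool

/-- The layout of the control wires: control `j` carries the test `layout ℓ j` (mixed-radix
digits of `j`). [folklore] -/
def layout (ℓ : ℕ) : Fin (numControls ℓ) ≃ TestLabel ℓ :=
  finProdFinEquiv.symm.trans <| Equiv.prodCongr (Equiv.refl _) <|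
    finProdFinEquiv.symm.trans <| Equiv.prodCongr (Equiv.refl _) <|
      finProdFinEquiv.symm.trans <| Equiv.prodCongr finTwoEquiv (Equiv.refl _)

/-- The trial of control `j`. [folklore] -/
def trialOf (ℓ : ℕ) (j : Fin (numControls ℓ)) : Fin numTrials := (layout ℓ j).1

/-- The level of control `j` (it controls `U^{2^level}`). [folklore] -/
def levelOf (ℓ : ℕ) (j : Fin (numControls ℓ)) : Fin (numLevels ℓ) := (layout ℓ j).2.1

/-- The exponents `e_j = level j` as natural numbers. [folklore] -/
def levels (ℓ : ℕ) (j : Fin (numControls ℓ)) : ℕ := (levelOf ℓ j : ℕ)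

/-- The type of control `j` (`true` = sine test, carrying the `S³` gate). [folklore] -/
def typeOf (ℓ : ℕ) (j : Fin (numControls ℓ)) : Bool := (layout ℓ j).2.2.1

/-- The block of control `j`. [folklore] -/
def blkOf (ℓ : ℕ) (j : Fin (numControls ℓ)) : Blk ℓ := (trialOf ℓ j, levelOf ℓ j, typeOf ℓ j)

/-- The controls of a block. [folklore] -/
def block (ℓ : ℕ) (β : Blk ℓ) : Finset (Fin (numControls ℓ)) := univ.filter fun j => blkOf ℓ j = β

/-- Membership in a block. [folklore] -/
theorem mem_block {ℓ : ℕ} {β : Blk ℓ} {j : Fin (numControls ℓ)} :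
    j ∈ block ℓ β ↔ trialOf ℓ j = β.1 ∧ levelOf ℓ j = β.2.1 ∧ typeOf ℓ j = β.2.2 := by
  obtain ⟨t, l, σ⟩ := β
  simp [block, blkOf]

/-- A block is the image of the repetitions under the inverse layout. [folklore] -/
theorem block_eq_image (ℓ : ℕ) (β : Blk ℓ) :
    block ℓ β = univ.image fun i : Fin (blockSize ℓ) => (layout ℓ).symm (β.1, β.2.1, β.2.2, i) := by
  ext j
  rw [mem_block, mem_image]
  constructor
  · rintro ⟨h1, h2, h3⟩
    refine ⟨(layout ℓ j).2.2.2, mem_univ _, ?_⟩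
    rw [Equiv.symm_apply_eq, ← h1, ← h2, ← h3]
    rfl
  · rintro ⟨i, -, rfl⟩
    simp [trialOf, levelOf, typeOf]

/-- Every block consists of `blockSize ℓ` controls. [folklore] -/
theorem card_block (ℓ : ℕ) (β : Blk ℓ) : (block ℓ β).card = blockSize ℓ := by
  rw [block_eq_image, card_image_of_injective _ fun i i' h => by simpa using h]
  simp

/-! ### The classical post-processing of a control read-out -/

/-- The number of `1`s read in block `β`. [cite: Kitaev1995, §3 (before Lemma 9: "count how many 1's")] -/
def cnt {ℓ : ℕ} (β : Blk ℓ) (γ : Fin (numControls ℓ) → Bool) : ℕ :=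
  ((block ℓ β).filter fun j => γ j = true).card

/-- The coarse localisation of `2^l φ_t`: the centre of the quadrant given by the signs of the
estimated cosine `1 - 2·cnt/B` and sine (as exact rationals). [cite: Kitaev1995, §3 Lemma 10] -/
def levelEst (ℓ : ℕ) (γ : Fin (numControls ℓ) → Bool) (t : Fin numTrials)
    (l : Fin (numLevels ℓ)) : ℚ :=
  quadrantCenter (decide (2 * cnt (t, l, false) γ ≤ blockSize ℓ))
    (decide (2 * cnt (t, l, true) γ ≤ blockSize ℓ))

/-- The refined estimate of the phase `φ_t = s_t / r` of trial `t` (halving from the top level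
down, over `ℚ`). [cite: Kitaev1995, §3 Lemma 10] -/
def phaseEst (ℓ : ℕ) (γ : Fin (numControls ℓ) → Bool) (t : Fin numTrials) : ℚ :=
  refined (fun l => if h : l < numLevels ℓ then levelEst ℓ γ t ⟨l, h⟩ else 0) (numLevels ℓ)

/-- **The order read off a control read-out**: the least common multiple over the trials of the
denominators `< n` of the fractions nearest to the phase estimates (Kitaev 1995, Thm. 1:
continued fractions recover `s_t/r` in lowest terms, denominator `r / gcd(s_t, r)`; §4: several
samples generate the whole group `ℤ/r`). [cite: Kitaev1995, §3 Thm 1 and §4] -/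
def orderEst (n ℓ : ℕ) (γ : Fin (numControls ℓ) → Bool) : ℕ :=
  univ.lcm fun t : Fin numTrials => Shor1997.candidate n (qOf ℓ) ((phaseEst ℓ γ t : ℚ) : ℝ)

/-! ### The hidden law of the read-out: product weights indexed by `s ∈ (ℤ/r)^K` -/

/-- The weight of outcome `b` of control `j` under the eigenvalue index `s`:
`(1 ± trig(2π s_{t(j)} 2^{l(j)} / r))/2`. [cite: Kitaev1995, §3 Remark 8] -/
def weight (ℓ r : ℕ) (s : Fin numTrials → Fin r) (j : Fin (numControls ℓ)) (b : Bool) : ℝ :=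
  testWeight b (typeOf ℓ j) (testAngle r (trialOf ℓ) (levels ℓ) s j)

/-- The success parameter of block `(t, l, σ)`: the weight of `1`. [folklore] -/
def blockParam (ℓ r : ℕ) (s : Fin numTrials → Fin r) (β : Blk ℓ) : ℝ :=
  testWeight true β.2.2 (2 * π * ((s β.1 : ℕ) : ℝ) * 2 ^ (β.2.1 : ℕ) / r)

/-- On block `β` the weights of `1` are constant, equal to `blockParam`. [folklore] -/
theorem weight_true_of_mem_block {ℓ r : ℕ} (s : Fin numTrials → Fin r) {β : Blk ℓ}
    {j : Fin (numControls ℓ)} (hj : j ∈ block ℓ β) : weight ℓ r s j true = blockParam ℓ r s β := by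
  obtain ⟨h1, h2, h3⟩ := mem_block.1 hj
  rw [weight, blockParam, testAngle, ← h1, ← h2, ← h3]
  rfl

/-- The mean number of `1`s in a block is `B · p_β`. [folklore] -/
theorem sum_weight_block {ℓ r : ℕ} (s : Fin numTrials → Fin r) (β : Blk ℓ) :
    ∑ j ∈ block ℓ β, weight ℓ r s j true = blockSize ℓ * blockParam ℓ r s β := by
  rw [sum_congr rfl fun j hj => weight_true_of_mem_block s hj, sum_const, card_block,
    nsmul_eq_mul]

/-- `Accurate s γ`: in every block the number of `1`s read is within `B/16` of its mean under
`s`. [cite: Kitaev1995, §3 (before Lemma 9)] -/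
def Accurate (ℓ r : ℕ) (s : Fin numTrials → Fin r) (γ : Fin (numControls ℓ) → Bool) : Prop :=
  ∀ β : Blk ℓ, |(cnt β γ : ℝ) - ∑ j ∈ block ℓ β, weight ℓ r s j true| < blockSize ℓ / 16

/-- `Good s`: the samples `s_t` have no common divisor `d ≥ 2` with `r`, i.e. they generate
`ℤ/r` (Kitaev 1995, §4). [cite: Kitaev1995, §4] -/
def Good (r : ℕ) (s : Fin numTrials → Fin r) : Prop :=
  ∀ d, 2 ≤ d → d ∣ r → ∃ t, ¬ d ∣ (s t : ℕ)

/-! ### Correctness of the post-processing on accurate read-outs -/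

/-- The block size is positive. [folklore] -/
theorem blockSize_pos (ℓ : ℕ) : 0 < blockSize ℓ := by
  unfold blockSize numLevels; omega

/-- `numLevels ℓ - 1 = 2ℓ`, so `2^(numLevels ℓ - 1) = qOf ℓ`. [folklore] -/
theorem two_pow_numLevels_sub_one (ℓ : ℕ) : (2 : ℚ) ^ (numLevels ℓ - 1) = qOf ℓ := by
  simp [numLevels, qOf]

/-- From an accurate count to an accurate trigonometric estimate: if `|cnt - B(1 - c₀)/2| < B/16`
then `ĉ = 1 - 2 cnt / B` satisfies `|ĉ - c₀| ≤ 1/8`, and `0 ≤ ĉ ↔ 2 cnt ≤ B`. [folklore] -/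
theorem trigEst_of_cnt {B c : ℕ} {c₀ : ℝ} (hB : 0 < B)
    (h : |(c : ℝ) - B * ((1 + (-1) * c₀) / 2)| < B / 16) :
    |(1 - 2 * (c : ℝ) / B) - c₀| ≤ 1 / 8 ∧ (decide (2 * c ≤ B) = true ↔ 0 ≤ 1 - 2 * (c : ℝ) / B) := by
  have hBr : (0 : ℝ) < B := by exact_mod_cast hB
  constructor
  · have : (1 - 2 * (c : ℝ) / B) - c₀ = (2 / B) * (B * ((1 + (-1) * c₀) / 2) - c) := by
      field_simp; ring
    rw [this, abs_mul, abs_of_pos (by positivity), abs_sub_comm]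
    rw [div_mul_eq_mul_div, div_le_iff₀ hBr]
    linarith
  · rw [decide_eq_true_iff, sub_nonneg, div_le_one hBr]
    constructor
    · intro h2; exact_mod_cast h2
    · intro h2; exact_mod_cast h2

/-- Bool form of the quadrant localisation over `ℚ`. [cite: Kitaev1995, §3 Lemma 10] -/
theorem cdist_quadrantCenter_le_bool {φ : ℚ} {c s : ℝ} {cb sb : Bool}
    (hcb : cb = true ↔ 0 ≤ c) (hsb : sb = true ↔ 0 ≤ s)
    (hc : |c - Real.cos (2 * π * φ)| ≤ 1 / 8) (hs : |s - Real.sin (2 * π * φ)| ≤ 1 / 8) :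
    cdist (quadrantCenter cb sb : ℚ) φ ≤ 5 / 32 := by
  have h1 : cb = decide (0 ≤ c) := by
    cases cb
    · symm; rw [decide_eq_false_iff_not]; exact fun h => by simpa using hcb.2 h
    · symm; rw [decide_eq_true_iff]; exact hcb.1 rfl
  have h2 : sb = decide (0 ≤ s) := by
    cases sb
    · symm; rw [decide_eq_false_iff_not]; exact fun h => by simpa using hsb.2 h
    · symm; rw [decide_eq_true_iff]; exact hsb.1 rfl
  subst h1 h2
  exact cdist_quadrantCenter_le_rat hc hs

/-- **Accurate read-outs localise every level**: `cdist (levelEst γ t l) (2^l s_t / r) ≤ 5/32`.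
[cite: Kitaev1995, §3 Lemma 10] -/
theorem cdist_levelEst_le {ℓ r : ℕ} {s : Fin numTrials → Fin r}
    {γ : Fin (numControls ℓ) → Bool} (hacc : Accurate ℓ r s γ) (t : Fin numTrials)
    (l : Fin (numLevels ℓ)) :
    cdist (levelEst ℓ γ t l) (2 ^ (l : ℕ) * ((s t : ℕ) : ℚ) / r) ≤ 5 / 32 := by
  have hB := blockSize_pos ℓ
  -- the two blocks of this trial and level
  have hcos := hacc (t, l, false)
  have hsin := hacc (t, l, true)
  rw [sum_weight_block] at hcos hsin
  simp only [blockParam, testWeight, if_true, if_false, Bool.false_eq_true] at hcos hsin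
  set θ : ℝ := 2 * π * ((s t : ℕ) : ℝ) * 2 ^ (l : ℕ) / r with hθ
  obtain ⟨hc1, hc2⟩ := trigEst_of_cnt (c₀ := Real.cos θ) hB hcos
  obtain ⟨hs1, hs2⟩ := trigEst_of_cnt (c₀ := Real.sin θ) hB hsin
  have hθ' : 2 * π * (((2 ^ (l : ℕ) * ((s t : ℕ) : ℚ) / r : ℚ)) : ℝ) = θ := by
    rw [hθ]; push_cast; ring
  unfold levelEst
  refine cdist_quadrantCenter_le_bool hc2 hs2 ?_ ?_
  · rw [hθ']; exact hc1
  · rw [hθ']; exact hs1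

/-- **Accurate read-outs estimate every phase to within `(5/32)/q`.**
[cite: Kitaev1995, §3 Lemma 10] -/
theorem cdist_phaseEst_le {ℓ r : ℕ} {s : Fin numTrials → Fin r}
    {γ : Fin (numControls ℓ) → Bool} (hacc : Accurate ℓ r s γ) (t : Fin numTrials) :
    cdist (phaseEst ℓ γ t) (((s t : ℕ) : ℚ) / r) ≤ 5 / 32 / qOf ℓ := by
  rw [phaseEst, ← two_pow_numLevels_sub_one]
  refine cdist_refined_le (by unfold numLevels; omega) fun l hl => ?_
  rw [dif_pos hl, show (2 : ℚ) ^ l * (((s t : ℕ) : ℚ) / r) = 2 ^ l * ((s t : ℕ) : ℚ) / r by ring]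
  exact cdist_levelEst_le hacc t ⟨l, hl⟩

/-- **The candidate of an accurate trial is `r / gcd(s_t, r)`** (Kitaev 1995, Thm. 1; Shor
1997, §5: the fraction `s_t/r` in lowest terms is recovered from any estimate within `1/2q`,
`q ≥ n²`). [cite: Kitaev1995, §3 Thm 1] -/
theorem candidate_phaseEst_eq {ℓ n r : ℕ} (hq : n ^ 2 ≤ qOf ℓ) (hr : 0 < r) (hrn : r < n)
    {s : Fin numTrials → Fin r} {γ : Fin (numControls ℓ) → Bool} (hacc : Accurate ℓ r s γ)
    (t : Fin numTrials) :
    Shor1997.candidate n (qOf ℓ) ((phaseEst ℓ γ t : ℚ) : ℝ) = r / Nat.gcd (s t) r := by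
  set sv : ℕ := (s t : ℕ) with hsv
  set g := Nat.gcd sv r with hg
  have hg0 : 0 < g := Nat.gcd_pos_of_pos_right _ hr
  have hgs : g ∣ sv := Nat.gcd_dvd_left _ _
  have hgr : g ∣ r := Nat.gcd_dvd_right _ _
  set r' := r / g with hr'
  set a := sv / g with ha
  have hr'0 : 0 < r' := Nat.div_pos (Nat.le_of_dvd hr hgr) hg0
  have hr'n : r' < n := lt_of_le_of_lt (Nat.div_le_self _ _) hrn
  have hcop : Nat.Coprime a r' := Nat.coprime_div_gcd_div_gcd hg0
  -- the estimate is within `(5/32)/q ≤ 1/2q` of `s/r + N` for some integer `N`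
  obtain ⟨N, hN⟩ := exists_cdist_eq (phaseEst ℓ γ t) (((s t : ℕ) : ℚ) / r)
  have hclose := cdist_phaseEst_le hacc t
  rw [hN] at hclose
  have hq0 : (0 : ℝ) < qOf ℓ := by unfold qOf; positivity
  -- `a / r' = s / r`
  have har : (a : ℝ) / r' = (sv : ℝ) / r := by
    have h1 : a * r = sv * r' := by
      rw [ha, hr']
      calc sv / g * r = sv / g * (r / g * g) := by rw [Nat.div_mul_cancel hgr]
        _ = sv / g * g * (r / g) := by ring
        _ = sv * (r / g) := by rw [Nat.div_mul_cancel hgs]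
    have hrr : (r : ℝ) ≠ 0 := by exact_mod_cast hr.ne'
    have hr'r : (r' : ℝ) ≠ 0 := by exact_mod_cast hr'0.ne'
    rw [div_eq_div_iff hr'r hrr]
    exact_mod_cast h1
  refine Shor1997.candidate_eq (d := (a : ℤ) + N * r') hq hr'0 hr'n ?_ ?_
  · exact (Nat.isCoprime_iff_coprime.2 hcop).add_mul_right_left N
  · have hcast : (((a : ℤ) + N * r' : ℤ) : ℝ) / (r' : ℝ) = (sv : ℝ) / r + N := by
      have hr'r : (r' : ℝ) ≠ 0 := by exact_mod_cast hr'0.ne'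
      push_cast
      rw [add_div, har, mul_div_assoc, div_self hr'r, mul_one]
    rw [hcast]
    have hle : ((|phaseEst ℓ γ t - ((s t : ℕ) : ℚ) / r - N| : ℚ) : ℝ) ≤ ((5 / 32 / qOf ℓ : ℚ) : ℝ) := by
      exact_mod_cast hclose
    push_cast at hle
    rw [show ((phaseEst ℓ γ t : ℚ) : ℝ) - ((sv : ℝ) / r + N) =
      (phaseEst ℓ γ t : ℝ) - (sv : ℝ) / r - N by ring]
    refine hle.trans ?_
    rw [div_le_div_iff₀ hq0 (by positivity)]
    nlinarith

/-- **lcm of the reduced denominators**: if the samples `s_t` have no common divisor `≥ 2` with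
`r`, then `lcm_t (r / gcd(s_t, r)) = r` (Kitaev 1995, §4: random elements generate the group
unless they lie in a common maximal proper subgroup). [cite: Kitaev1995, §4] -/
theorem lcm_div_gcd_eq {r : ℕ} (hr : 0 < r) {s : Fin numTrials → Fin r} (hs : Good r s) :
    (univ.lcm fun t : Fin numTrials => r / Nat.gcd (s t) r) = r := by
  set M := univ.lcm fun t : Fin numTrials => r / Nat.gcd (s t) r with hM
  have hMr : M ∣ r := Finset.lcm_dvd fun t _ => Nat.div_dvd_of_dvd (Nat.gcd_dvd_right _ _)
  -- the gcd of the `gcd(s_t, r)` is `1`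
  set G := univ.gcd fun t : Fin numTrials => Nat.gcd (s t) r with hG
  have hGt : ∀ t, G ∣ Nat.gcd (s t) r := fun t => Finset.gcd_dvd (mem_univ t)
  have t0 : Fin numTrials := ⟨0, by unfold numTrials; omega⟩
  have hGr : G ∣ r := (hGt t0).trans (Nat.gcd_dvd_right _ _)
  have hG1 : G = 1 := by
    have hG0 : G ≠ 0 := fun h => hr.ne' (Nat.eq_zero_of_zero_dvd (h ▸ hGr))
    by_contra hne
    obtain ⟨t, ht⟩ := hs G (by omega) hGr
    exact ht ((hGt t).trans (Nat.gcd_dvd_left _ _))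
  -- `r ∣ M · gcd(s_t, r)` for every `t`, hence `r ∣ M · G = M`
  have hrM : ∀ t, r ∣ M * Nat.gcd (s t) r := by
    intro t
    have h1 : r / Nat.gcd (s t) r ∣ M := Finset.dvd_lcm (mem_univ t)
    have h2 := Nat.mul_dvd_mul_right h1 (Nat.gcd (s t) r)
    rwa [Nat.div_mul_cancel (Nat.gcd_dvd_right _ _)] at h2
  have hrMG : r ∣ univ.gcd fun t : Fin numTrials => M * Nat.gcd (s t) r :=
    Finset.dvd_gcd fun t _ => hrM t
  rw [Finset.gcd_mul_left, normalize_eq, ← hG, hG1, mul_one] at hrMG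
  exact Nat.dvd_antisymm hMr hrMG

/-- **Correctness of the post-processing** (Kitaev 1995, §3 Lemma 10 + Thm. 1 + §4): on an
accurate read-out with good samples the order read off is `r`.
[cite: Kitaev1995, §3 Thm 1 and §4] -/
theorem orderEst_eq {ℓ n r : ℕ} (hq : n ^ 2 ≤ qOf ℓ) (hr : 0 < r) (hrn : r < n)
    {s : Fin numTrials → Fin r} (hs : Good r s) {γ : Fin (numControls ℓ) → Bool}
    (hacc : Accurate ℓ r s γ) : orderEst n ℓ γ = r := by
  unfold orderEst
  rw [show (fun t : Fin numTrials => Shor1997.candidate n (qOf ℓ) ((phaseEst ℓ γ t : ℚ) : ℝ)) =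
      fun t => r / Nat.gcd (s t) r from funext fun t => candidate_phaseEst_eq hq hr hrn hacc t]
  exact lcm_div_gcd_eq hr hs


/-! ### The weights are a product probability distribution -/

/-- Test weights are nonnegative. [folklore] -/
theorem testWeight_nonneg (b σ : Bool) (θ : ℝ) : 0 ≤ testWeight b σ θ := by
  have h1 := Real.neg_one_le_cos θ
  have h2 := Real.cos_le_one θ
  have h3 := Real.neg_one_le_sin θ
  have h4 := Real.sin_le_one θ
  unfold testWeight
  cases b <;> cases σ <;> simp <;> linarith

/-- The two outcomes of a test have total weight `1`. [folklore] -/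
theorem testWeight_false_add_true (σ : Bool) (θ : ℝ) :
    testWeight false σ θ + testWeight true σ θ = 1 := by
  unfold testWeight
  cases σ <;> simp <;> ring

/-- The weights of the experiment are nonnegative. [folklore] -/
theorem weight_nonneg (ℓ r : ℕ) (s : Fin numTrials → Fin r) (j : Fin (numControls ℓ)) (b : Bool) :
    0 ≤ weight ℓ r s j b :=
  testWeight_nonneg _ _ _

/-- The weights of the experiment are normalised. [folklore] -/
theorem weight_false_add_true (ℓ r : ℕ) (s : Fin numTrials → Fin r) (j : Fin (numControls ℓ)) :
    weight ℓ r s j false + weight ℓ r s j true = 1 :=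
  testWeight_false_add_true _ _

/-! ### Few samples are bad: `#{s : ¬ Good s} ≤ r^K / 8` -/

/-- The tuples all of whose entries are multiples of a divisor `d` of `r` number at most
`(r/d)^K`. [folklore] -/
theorem card_filter_forall_dvd_le {r K d : ℕ} (hdr : d ∣ r) :
    (univ.filter fun s : Fin K → Fin r => ∀ t, d ∣ (s t : ℕ)).card ≤ (r / d) ^ K := by
  classical
  have hcard : (univ : Finset (Fin K → Fin (r / d))).card = (r / d) ^ K := by
    rw [card_univ, Fintype.card_fun, Fintype.card_fin, Fintype.card_fin]
  rw [← hcard]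
  refine card_le_card_of_injOn
    (fun s t => (⟨(s t : ℕ) / d, Nat.div_lt_div_of_lt_of_dvd hdr (s t).isLt⟩ : Fin (r / d)))
    (fun s _ => mem_coe.2 (mem_univ _)) ?_
  intro s hs s' hs' h
  simp only [coe_filter, Set.mem_setOf_eq, mem_univ, true_and] at hs hs'
  funext t
  apply Fin.ext
  have ht := congrFun h t
  simp only [Fin.mk.injEq] at ht
  rw [← Nat.div_mul_cancel (hs t), ← Nat.div_mul_cancel (hs' t), ht]

/-- `∑_{d=2}^{r} 1/d⁴ ≤ 1/8 - 1/(8r)` (by `1/(d+1)⁴ ≤ 1/(8d(d+1))`, telescoping). [folklore] -/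
theorem sum_Icc_inv_pow_four_le (r : ℕ) :
    ∑ d ∈ Icc 2 r, (1 : ℝ) / (d : ℝ) ^ 4 ≤ 1 / 8 - 1 / (8 * r) := by
  induction r with
  | zero => simp
  | succ r ih =>
    rcases Nat.eq_zero_or_pos r with rfl | hr
    · simp
    · rw [sum_Icc_succ_top (by omega)]
      have hr1 : (1 : ℝ) ≤ r := by exact_mod_cast hr
      have key : (1 : ℝ) / ((r + 1 : ℕ) : ℝ) ^ 4 ≤ 1 / (8 * r) - 1 / (8 * ((r + 1 : ℕ) : ℝ)) := by
        push_cast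
        rw [show (1 : ℝ) / (8 * r) - 1 / (8 * (r + 1)) = 1 / (8 * r * (r + 1)) by
          field_simp; ring]
        apply one_div_le_one_div_of_le (by positivity)
        have h3 : 8 * (r : ℝ) ≤ (r + 1) ^ 3 := by nlinarith [sq_nonneg ((r : ℝ) - 1)]
        nlinarith
      linarith

open scoped Classical in
/-- **Bad samples are rare**: the tuples `s ∈ (ℤ/r)^4` whose entries have a common divisor
`≥ 2` with `r` number at most `r⁴/8` (`∑_{d ∣ r, d ≥ 2} (r/d)⁴ ≤ r⁴ ∑_{d ≥ 2} d⁻⁴ ≤ r⁴/8`;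
cf. Kitaev 1995, §4, where the failure of `l` samples to generate is bounded subgroup by
subgroup). [cite: Kitaev1995, §4] -/
theorem card_not_good_le {r : ℕ} (hr : 0 < r) :
    ((univ.filter fun s : Fin numTrials → Fin r => ¬ Good r s).card : ℝ) ≤ (r : ℝ) ^ numTrials / 8 := by
  classical
  set D := (Icc 2 r).filter (· ∣ r) with hD
  have hsub : (univ.filter fun s : Fin numTrials → Fin r => ¬ Good r s) ⊆
      D.biUnion fun d => univ.filter fun s : Fin numTrials → Fin r => ∀ t, d ∣ (s t : ℕ) := by
    intro s hs
    simp only [mem_filter, mem_univ, true_and, Good, not_forall, not_exists, not_not,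
      exists_prop] at hs
    obtain ⟨d, hd2, hdr, hds⟩ := hs
    simp only [mem_biUnion, mem_filter, mem_univ, true_and, hD, mem_Icc]
    exact ⟨d, ⟨⟨hd2, Nat.le_of_dvd hr hdr⟩, hdr⟩, hds⟩
  have h1 : ((univ.filter fun s : Fin numTrials → Fin r => ¬ Good r s).card : ℝ) ≤
      ∑ d ∈ D, (((r / d) ^ numTrials : ℕ) : ℝ) := by
    have := (card_le_card hsub).trans (card_biUnion_le.trans
      (sum_le_sum fun d hd => card_filter_forall_dvd_le (K := numTrials) (mem_filter.1 hd).2))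
    exact_mod_cast this
  refine h1.trans ?_
  have h2 : ∀ d ∈ D, (((r / d) ^ numTrials : ℕ) : ℝ) = (r : ℝ) ^ numTrials * (1 / (d : ℝ) ^ 4) := by
    intro d hd
    obtain ⟨hd1, hd2⟩ := mem_filter.1 hd
    have hd0 : (d : ℝ) ≠ 0 := by
      have : 2 ≤ d := (mem_Icc.1 hd1).1
      exact_mod_cast (show d ≠ 0 by omega)
    push_cast
    rw [Nat.cast_div hd2 hd0, div_pow, numTrials]
    ring
  rw [sum_congr rfl h2, ← mul_sum]
  have h3 : ∑ d ∈ D, (1 : ℝ) / (d : ℝ) ^ 4 ≤ 1 / 8 := by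
    calc ∑ d ∈ D, (1 : ℝ) / (d : ℝ) ^ 4 ≤ ∑ d ∈ Icc 2 r, (1 : ℝ) / (d : ℝ) ^ 4 :=
          sum_le_sum_of_subset_of_nonneg (filter_subset _ _) fun d _ _ => by positivity
      _ ≤ 1 / 8 - 1 / (8 * r) := sum_Icc_inv_pow_four_le r
      _ ≤ 1 / 8 := by
        have : (0 : ℝ) ≤ 1 / (8 * r) := by positivity
        linarith
  calc (r : ℝ) ^ numTrials * ∑ d ∈ D, (1 : ℝ) / (d : ℝ) ^ 4 ≤ (r : ℝ) ^ numTrials * (1 / 8) :=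
        mul_le_mul_of_nonneg_left h3 (by positivity)
    _ = (r : ℝ) ^ numTrials / 8 := by ring

open scoped Classical in
/-- **Good samples are frequent**: at least `7/8` of all `s ∈ (ℤ/r)^4` are good.
[cite: Kitaev1995, §4] -/
theorem card_good_ge {r : ℕ} (hr : 0 < r) :
    7 / 8 * (r : ℝ) ^ numTrials ≤ ((univ.filter fun s : Fin numTrials → Fin r => Good r s).card : ℝ) := by
  classical
  have htot : ((univ.filter fun s : Fin numTrials → Fin r => Good r s).card : ℝ) +
      ((univ.filter fun s : Fin numTrials → Fin r => ¬ Good r s).card : ℝ) = (r : ℝ) ^ numTrials := by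
    have := card_filter_add_card_filter_not (s := (univ : Finset (Fin numTrials → Fin r)))
      (Good r)
    rw [card_univ, Fintype.card_fun, Fintype.card_fin, Fintype.card_fin] at this
    exact_mod_cast this
  have := card_not_good_le hr
  linarith

/-! ### Accurate read-outs are likely: Chebyshev and a union bound over the blocks -/

/-- Union bound for nonnegative weights: the mass of `{x | ∃ i, P i x}` is at most the sum of
the masses of the `{x | P i x}`. [folklore] -/
theorem sum_filter_exists_le {ι X : Type*} [Fintype ι] [Fintype X] (f : X → ℝ)
    (hf : ∀ x, 0 ≤ f x) (P : ι → X → Prop) [∀ i, DecidablePred (P i)]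
    [DecidablePred fun x => ∃ i, P i x] :
    ∑ x ∈ univ.filter (fun x => ∃ i, P i x), f x ≤ ∑ i, ∑ x ∈ univ.filter (P i), f x := by
  classical
  have hR : ∑ i, ∑ x ∈ univ.filter (P i), f x =
      ∑ x, f x * ((univ.filter fun i => P i x).card : ℝ) := by
    simp_rw [sum_filter]
    rw [sum_comm]
    refine sum_congr rfl fun x _ => ?_
    rw [← sum_filter, sum_const, nsmul_eq_mul, mul_comm]
  rw [hR, sum_filter]
  refine sum_le_sum fun x _ => ?_
  split_ifs with h
  · obtain ⟨i, hi⟩ := h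
    have : (1 : ℝ) ≤ ((univ.filter fun i => P i x).card : ℝ) := by
      have : 0 < (univ.filter fun i => P i x).card := card_pos.2 ⟨i, by simp [hi]⟩
      exact_mod_cast this
    nlinarith [hf x]
  · exact mul_nonneg (hf x) (Nat.cast_nonneg _)

/-- The number of blocks is `8 · numLevels ℓ`. [folklore] -/
theorem card_blk (ℓ : ℕ) : Fintype.card (Blk ℓ) = 8 * numLevels ℓ := by
  simp only [Fintype.card_prod, Fintype.card_fin, Fintype.card_bool]
  unfold numTrials
  ring

open scoped Classical in
/-- **Inaccurate read-outs are rare**: under every `s` the read-outs that are not accurate have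
total weight `≤ 1/12` (Chebyshev per block, `chebyshev_block`, and a union bound over the
`8 (2ℓ+1)` blocks of size `6144 (2ℓ+1)`). [cite: Kitaev1995, §3 (before Lemma 9)] -/
theorem sum_not_accurate_le (ℓ r : ℕ) (s : Fin numTrials → Fin r) :
    ∑ γ ∈ univ.filter (fun γ => ¬ Accurate ℓ r s γ), ∏ j, weight ℓ r s j (γ j) ≤ 1 / 12 := by
  classical
  have hB := blockSize_pos ℓ
  have hBr : (0 : ℝ) < blockSize ℓ := by exact_mod_cast hB
  -- `¬ Accurate` is a union over the blocks of large deviations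
  have hsub : (univ.filter fun γ => ¬ Accurate ℓ r s γ) =
      univ.filter fun γ : Fin (numControls ℓ) → Bool => ∃ β : Blk ℓ,
        (blockSize ℓ : ℝ) / 16 ≤ |(cnt β γ : ℝ) - ∑ j ∈ block ℓ β, weight ℓ r s j true| := by
    refine filter_congr fun γ _ => ?_
    simp only [Accurate, not_forall, not_lt]
  rw [hsub]
  refine (sum_filter_exists_le _ (fun γ => prod_nonneg fun j _ => weight_nonneg ℓ r s j _) _).trans ?_
  have hblock : ∀ β : Blk ℓ, ∑ γ ∈ univ.filter (fun γ : Fin (numControls ℓ) → Bool =>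
      (blockSize ℓ : ℝ) / 16 ≤ |(cnt β γ : ℝ) - ∑ j ∈ block ℓ β, weight ℓ r s j true|),
        ∏ j, weight ℓ r s j (γ j) ≤ 64 / blockSize ℓ := by
    intro β
    have h := chebyshev_block (weight ℓ r s) (weight_nonneg ℓ r s) (weight_false_add_true ℓ r s)
      (block ℓ β) (a := (blockSize ℓ : ℝ) / 16) (by positivity)
    rw [card_block] at h
    refine (le_of_eq ?_).trans (h.trans (le_of_eq ?_))
    · rfl
    · field_simp
      ring
  calc ∑ β : Blk ℓ, ∑ γ ∈ univ.filter (fun γ : Fin (numControls ℓ) → Bool =>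
        (blockSize ℓ : ℝ) / 16 ≤ |(cnt β γ : ℝ) - ∑ j ∈ block ℓ β, weight ℓ r s j true|),
          ∏ j, weight ℓ r s j (γ j)
      ≤ ∑ _β : Blk ℓ, (64 : ℝ) / blockSize ℓ := sum_le_sum fun β _ => hblock β
    _ = (8 * numLevels ℓ : ℕ) * ((64 : ℝ) / blockSize ℓ) := by
        rw [sum_const, card_univ, card_blk, nsmul_eq_mul]
    _ = 1 / 12 := by
        have hL : (0 : ℝ) < numLevels ℓ := by unfold numLevels; positivity
        simp only [blockSize, Nat.cast_mul, Nat.cast_ofNat]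
        field_simp
        ring

open scoped Classical in
/-- **Accurate read-outs are likely**: total weight `≥ 11/12` under every `s`.
[cite: Kitaev1995, §3 (before Lemma 9)] -/
theorem sum_accurate_ge (ℓ r : ℕ) (s : Fin numTrials → Fin r) :
    11 / 12 ≤ ∑ γ ∈ univ.filter (fun γ => Accurate ℓ r s γ), ∏ j, weight ℓ r s j (γ j) := by
  classical
  have htot := sum_prodWeight (weight ℓ r s) (weight_false_add_true ℓ r s)
  rw [← sum_filter_add_sum_filter_not univ (fun γ => Accurate ℓ r s γ)] at htot
  have := sum_not_accurate_le ℓ r s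
  linarith

/-! ### The success probability of the experiment -/

section success

variable {ℓ m : ℕ}

/-- **Success bound for Kitaev's order-finding experiment.** For a classical block computing
`|x y 0⟩ ↦ |x y (R y)⟩` with `R` separating exactly the residues of the trial exponents
modulo `r`, every set `E` of control read-outs that contains all accurate read-outs of all good
samples has Born probability `≥ (7/8)(11/12) = 77/96`: the read-out law is the uniform mixture
over `s ∈ (ℤ/r)^4` of product weights (`kitaevCircuit_distribution`), good `s` have mass
`≥ 7/8` (`card_good_ge`) and accurate read-outs mass `≥ 11/12` under each `s`
(`sum_accurate_ge`). [cite: Kitaev1995, §3 (Lemma 10, Thm 1) and §4] -/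
theorem kitaev_success (V : QCircuit cliffordT (ℓ + (numControls ℓ + m))) (x : QReg ℓ)
    (R : QReg (numControls ℓ) → QReg m)
    (hV : ∀ y, V.toMatrix 0 *ᵥ basisState (coinInput x y) = basisState (tri x y (R y)))
    {r : ℕ} (hr : 0 < r)
    (hR : ∀ y y', R y = R y' ↔
      ∀ t, (r : ℤ) ∣ (trialExp (trialOf ℓ) (levels ℓ) t y : ℤ) - (trialExp (trialOf ℓ) (levels ℓ) t y' : ℤ))
    (E : Finset (QReg (numControls ℓ)))
    (hE : ∀ s : Fin numTrials → Fin r, Good r s → ∀ γ, Accurate ℓ r s γ → γ ∈ E) :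
    77 / 96 ≤ ∑ γ ∈ E, ∑ ρ : QReg m,
      ‖(kitaevCircuit V (typeOf ℓ)).runOn 0 (basisState (padInput x (numControls ℓ + m)))
        (tri x γ ρ)‖ ^ 2 := by
  classical
  simp_rw [kitaevCircuit_distribution V (typeOf ℓ) x R hV hr (trialOf ℓ) (levels ℓ) hR]
  rw [← mul_sum, Fintype.card_fin]
  change 77 / 96 ≤ 1 / (r : ℝ) ^ numTrials * ∑ γ ∈ E, ∑ s : Fin numTrials → Fin r,
    ∏ j, weight ℓ r s j (γ j)
  rw [sum_comm]
  have hrK : (0 : ℝ) < (r : ℝ) ^ numTrials := by positivity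
  -- restrict to good samples, then to accurate read-outs
  have hW0 : ∀ (s : Fin numTrials → Fin r) (γ : Fin (numControls ℓ) → Bool),
      0 ≤ ∏ j, weight ℓ r s j (γ j) := fun s γ => prod_nonneg fun j _ => weight_nonneg ℓ r s j _
  have h1 : ∑ s ∈ univ.filter (fun s => Good r s), (11 / 12 : ℝ) ≤
      ∑ s : Fin numTrials → Fin r, ∑ γ ∈ E, ∏ j, weight ℓ r s j (γ j) := by
    calc ∑ s ∈ univ.filter (fun s => Good r s), (11 / 12 : ℝ)
        ≤ ∑ s ∈ univ.filter (fun s => Good r s), ∑ γ ∈ E, ∏ j, weight ℓ r s j (γ j) := by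
          refine sum_le_sum fun s hs => ?_
          have hs' : Good r s := (mem_filter.1 hs).2
          calc (11 / 12 : ℝ) ≤ ∑ γ ∈ univ.filter (fun γ => Accurate ℓ r s γ), ∏ j, weight ℓ r s j (γ j) :=
                sum_accurate_ge ℓ r s
            _ ≤ ∑ γ ∈ E, ∏ j, weight ℓ r s j (γ j) :=
                sum_le_sum_of_subset_of_nonneg (fun γ hγ => hE s hs' γ (mem_filter.1 hγ).2)
                  fun γ _ _ => hW0 s γ
      _ ≤ ∑ s : Fin numTrials → Fin r, ∑ γ ∈ E, ∏ j, weight ℓ r s j (γ j) :=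
          sum_le_sum_of_subset_of_nonneg (filter_subset _ _) fun s _ _ =>
            sum_nonneg fun γ _ => hW0 s γ
  rw [sum_const, nsmul_eq_mul] at h1
  have h2 := card_good_ge (r := r) hr
  have h3 : 7 / 8 * (r : ℝ) ^ numTrials * (11 / 12) ≤
      ∑ s : Fin numTrials → Fin r, ∑ γ ∈ E, ∏ j, weight ℓ r s j (γ j) :=
    le_trans (mul_le_mul_of_nonneg_right h2 (by norm_num)) h1
  calc (77 / 96 : ℝ) = 1 / (r : ℝ) ^ numTrials * (7 / 8 * (r : ℝ) ^ numTrials * (11 / 12)) := by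
        field_simp; ring
    _ ≤ 1 / (r : ℝ) ^ numTrials * ∑ s : Fin numTrials → Fin r, ∑ γ ∈ E, ∏ j, weight ℓ r s j (γ j) :=
        mul_le_mul_of_nonneg_left h3 (by positivity)

end success

/-! ### From Born masses to the kernel of a family -/

section kernel

variable {ℓ k m : ℕ}

open scoped Classical in
/-- Over Clifford+T the probability that the classical output of a circuit run on `|x⟩|0…0⟩`
lies in `S` is the Born mass of the basis labels whose read-out lies in `S`
(`QCircuit.outputPMF_apply_holds`, `cliffordT_isUnitary_holds`). [folklore] -/
theorem toReal_outputPMF_map_toOuterMeasure {n m' : ℕ} (C : QCircuit cliffordT (n + m'))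
    (x : QReg n) (S : Set (List Bool)) :
    (((C.outputPMF 0 x).map List.ofFn).toOuterMeasure S).toReal =
      ∑ z : QReg (n + m'), if List.ofFn z ∈ S then ‖C.runOn 0 (basisState (padInput x m')) z‖ ^ 2
        else 0 := by
  rw [PMF.toOuterMeasure_map_apply, PMF.toOuterMeasure_apply, tsum_fintype,
    ENNReal.toReal_sum (fun y _ => ?_)]
  · refine Finset.sum_congr rfl fun y _ => ?_
    simp only [Set.indicator, Set.mem_preimage]
    split_ifs with h
    · rw [QCircuit.outputPMF_apply_holds cliffordT_isUnitary_holds, ENNReal.toReal_ofReal (sq_nonneg _)]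
    · rfl
  · simp only [Set.indicator]
    split_ifs
    · rw [QCircuit.outputPMF_apply_holds cliffordT_isUnitary_holds]; exact ENNReal.ofReal_ne_top
    · exact ENNReal.zero_ne_top

open scoped Classical in
/-- A lower bound for a Born mass by the labels `x γ ρ` with `γ` in a set of control read-outs
all of whose completions are favourable. [folklore] -/
theorem sum_tri_le_sum_ite (ψ : QReg (ℓ + (k + m)) → ℂ) (x : QReg ℓ) (S : Set (List Bool))
    (E : Finset (QReg k)) (hE : ∀ γ ∈ E, ∀ ρ : QReg m, List.ofFn (tri x γ ρ) ∈ S) :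
    ∑ γ ∈ E, ∑ ρ : QReg m, ‖ψ (tri x γ ρ)‖ ^ 2 ≤
      ∑ z : QReg (ℓ + (k + m)), if List.ofFn z ∈ S then ‖ψ z‖ ^ 2 else 0 := by
  have hinj : Set.InjOn (fun p : QReg k × QReg m => tri x p.1 p.2) ↑(E ×ˢ (univ : Finset (QReg m))) := by
    rintro ⟨γ, ρ⟩ - ⟨γ', ρ'⟩ - h
    obtain ⟨-, h1, h2⟩ := tri_eq_tri_iff.1 h
    exact Prod.ext h1 h2
  calc ∑ γ ∈ E, ∑ ρ : QReg m, ‖ψ (tri x γ ρ)‖ ^ 2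
      = ∑ p ∈ E ×ˢ (univ : Finset (QReg m)), ‖ψ (tri x p.1 p.2)‖ ^ 2 := by rw [sum_product]
    _ = ∑ z ∈ (E ×ˢ (univ : Finset (QReg m))).image (fun p => tri x p.1 p.2), ‖ψ z‖ ^ 2 := by
        rw [sum_image hinj]
    _ = ∑ z ∈ (E ×ˢ (univ : Finset (QReg m))).image (fun p => tri x p.1 p.2),
          (if List.ofFn z ∈ S then ‖ψ z‖ ^ 2 else 0) := by
        refine sum_congr rfl fun z hz => ?_
        obtain ⟨⟨γ, ρ⟩, hp, rfl⟩ := mem_image.1 hz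
        rw [if_pos (hE γ (mem_product.1 hp).1 ρ)]
    _ ≤ ∑ z, (if List.ofFn z ∈ S then ‖ψ z‖ ^ 2 else 0) :=
        sum_le_sum_of_subset_of_nonneg (subset_univ _) fun z _ _ => by
          split_ifs <;> positivity

end kernel

/-! ### The family and its classical post-processor -/

/-- Kitaev's order-finding family: on inputs of length `ℓ`, Kitaev's circuit with
`numControls ℓ` control wires laid out by `layout ℓ` (sine tests marked by `typeOf ℓ`) around
the classical block `V ℓ` using `mW ℓ` work wires. [cite: Kitaev1995, §3 (Remark 8, Lemma 10)] -/
def kitaevFamily (mW : ℕ → ℕ) (V : (ℓ : ℕ) → QCircuit cliffordT (ℓ + (numControls ℓ + mW ℓ))) :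
    QCircuitFamily cliffordT :=
  ⟨fun ℓ => numControls ℓ + mW ℓ, fun ℓ => kitaevCircuit (V ℓ) (typeOf ℓ)⟩

/-- Kitaev's family is oracle-free if its blocks are. [folklore] -/
theorem kitaevFamily_isOracleFree {mW : ℕ → ℕ}
    {V : (ℓ : ℕ) → QCircuit cliffordT (ℓ + (numControls ℓ + mW ℓ))} (hV : ∀ ℓ, (V ℓ).IsOracleFree) :
    (kitaevFamily mW V).IsOracleFree := fun ℓ =>
  kitaevCircuit_isOracleFree (hV ℓ) _

/-- The control bits of a measured output string `y` of the family on an input of length `ℓ`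
(wires `ℓ, …, ℓ + numControls ℓ - 1`). [folklore] -/
def readControls (ℓ : ℕ) (y : List Bool) : Fin (numControls ℓ) → Bool :=
  fun j => y.getD (ℓ + j) false

/-- **The classical post-processor of the order-finding family.** Input `⟨w, y⟩`: the instance
`w = ⟨x, n⟩` and the measured output `y`; output the binary encoding of the order read off the
control bits of `y` (`orderEst`: counts per block, quadrant centres, halving refinement over `ℚ`,
nearest fraction with denominator `< n` by continued fractions, `lcm` over the trials); `[]` if
`w` is not a pair of numerals. [cite: Kitaev1995, §3 (Lemma 10, Thm 1) and §4] -/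
def orderFindingPost (z : List Bool) : List Bool :=
  match natPairEncoding.decode (boolUnpair z).1 with
  | none => []
  | some p => encodeNat (orderEst p.2 (boolUnpair z).1.length
      (readControls (boolUnpair z).1.length (boolUnpair z).2))

/-- Reading the controls off the read-out of a label `x γ ρ` gives `γ`. [folklore] -/
theorem readControls_ofFn_tri {ℓ m : ℕ} (x : QReg ℓ) (γ : Fin (numControls ℓ) → Bool)
    (ρ : QReg m) : readControls ℓ (List.ofFn (tri x γ ρ)) = γ := by
  funext j
  have hj : ℓ + (j : ℕ) < ℓ + (numControls ℓ + m) := by have := j.isLt; omega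
  rw [readControls, List.getD_eq_getElem?_getD, List.getElem?_ofFn]
  simp only [hj, dite_true, Option.getD_some]
  have : (⟨ℓ + (j : ℕ), hj⟩ : Fin (ℓ + (numControls ℓ + m))) = coinWire ℓ (numControls ℓ) m j :=
    Fin.ext (by rw [val_coinWire])
  rw [this, tri_coinWire]

/-- **The post-processor on the output of the family**: on `⟨⟨x, n⟩, read-out of x γ ρ⟩` it
returns the encoding of `orderEst n ℓ γ`. [folklore] -/
theorem orderFindingPost_boolPair {m : ℕ} (x n : ℕ) (γ : Fin (numControls (encodeOrderInstance x n).length) → Bool)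
    (ρ : QReg m) :
    orderFindingPost (boolPair (encodeOrderInstance x n)
      (List.ofFn (tri (encodeOrderInstance x n).get γ ρ))) =
      encodeNat (orderEst n (encodeOrderInstance x n).length γ) := by
  have hdec : natPairEncoding.decode (encodeOrderInstance x n) = some (x, n) :=
    natPairEncoding.decode_encode (x, n)
  unfold orderFindingPost
  rw [boolUnpair_boolPair]
  simp only [hdec, readControls_ofFn_tri]

/-! ### Instances: the modulus, the order, the encoding -/

/-- On the promise, modular powers agree iff the exponents agree modulo the order. [folklore] -/
theorem pow_modEq_pow_iff_dvd_sub {x n : ℕ} (hn : 1 < n) (hx : x.Coprime n) (a b : ℕ) :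
    x ^ a ≡ x ^ b [MOD n] ↔ ((orderOf (x : ZMod n) : ℕ) : ℤ) ∣ (a : ℤ) - (b : ℤ) := by
  have hfin : IsOfFinOrder (x : ZMod n) := orderOf_pos_iff.1 (Shor1997.orderOf_pos_and_lt hn hx).1
  rw [← ZMod.natCast_eq_natCast_iff, Nat.cast_pow, Nat.cast_pow, hfin.pow_eq_pow_iff_modEq,
    Nat.modEq_iff_dvd, dvd_sub_comm]

/-- The modulus of an instance is below `2^ℓ`, so `n² ≤ q = 4^ℓ`. [folklore] -/
theorem sq_le_qOf (x n : ℕ) : n ^ 2 ≤ qOf (encodeOrderInstance x n).length := by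
  have h1 : n < 2 ^ (encodeNat n).length := by
    simpa using bitsToNat_lt (encodeNat n)
  have h2 : (encodeNat n).length ≤ (encodeOrderInstance x n).length := by
    have : (encodeOrderInstance x n).length = 2 * (encodeNat x).length + 2 + (encodeNat n).length :=
      length_boolPair _ _
    omega
  have h3 : n < 2 ^ (encodeOrderInstance x n).length :=
    lt_of_lt_of_le h1 (Nat.pow_le_pow_right (by norm_num) h2)
  unfold qOf
  rw [pow_mul, show (2 : ℕ) ^ 2 = 4 by norm_num]
  calc n ^ 2 ≤ (2 ^ (encodeOrderInstance x n).length) ^ 2 := Nat.pow_le_pow_left h3.le 2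
    _ = 4 ^ (encodeOrderInstance x n).length := by rw [← pow_mul, mul_comm, pow_mul]; norm_num

/-- The instance encoding is injective. [folklore] -/
theorem encodeOrderInstance_injective {x n x' n' : ℕ}
    (h : encodeOrderInstance x n = encodeOrderInstance x' n') : x = x' ∧ n = n' := by
  have := natPairEncoding.encode_injective h
  simpa using this

/-- **The on-promise bound.** On an instance `⟨x, n⟩` with `1 < n`, `gcd(x, n) = 1`, Kitaev's
family with a correct block outputs, with probability `≥ 77/96`, a string on which the
post-processor returns the encoding of `ord_n(x)`. [cite: Kitaev1995, §3–§4] -/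
theorem kernelProb_orderFindingPost_ge {mW : ℕ → ℕ}
    {V : (ℓ : ℕ) → QCircuit cliffordT (ℓ + (numControls ℓ + mW ℓ))} (x n : ℕ) (hn : 1 < n)
    (hx : x.Coprime n)
    (R : QReg (numControls (encodeOrderInstance x n).length) →
      QReg (mW (encodeOrderInstance x n).length))
    (hV : ∀ y, (V (encodeOrderInstance x n).length).toMatrix 0 *ᵥ
        basisState (coinInput (encodeOrderInstance x n).get y) =
          basisState (tri (encodeOrderInstance x n).get y (R y)))
    (hR : ∀ y y', R y = R y' ↔ ∀ t,
      x ^ trialExp (trialOf _) (levels _) t y ≡ x ^ trialExp (trialOf _) (levels _) t y' [MOD n]) :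
    77 / 96 ≤ (kitaevFamily mW V).kernelProb 0 (encodeOrderInstance x n)
      {z | orderFindingPost (boolPair (encodeOrderInstance x n) z) = encodeNat (orderOf (x : ZMod n))} := by
  classical
  obtain ⟨hr0, hrn⟩ := Shor1997.orderOf_pos_and_lt hn hx
  have hR' : ∀ y y', R y = R y' ↔ ∀ t, ((orderOf (x : ZMod n) : ℕ) : ℤ) ∣
      (trialExp (trialOf (encodeOrderInstance x n).length) (levels _) t y : ℤ) -
        (trialExp (trialOf (encodeOrderInstance x n).length) (levels _) t y' : ℤ) := by
    intro y y'
    rw [hR]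
    exact forall_congr' fun t => pow_modEq_pow_iff_dvd_sub hn hx _ _
  -- the favourable control read-outs: those on which `orderEst` returns the order
  have hE1 : ∀ s : Fin numTrials → Fin (orderOf (x : ZMod n)), Good _ s → ∀ γ,
      Accurate (encodeOrderInstance x n).length _ s γ →
        γ ∈ univ.filter fun γ => orderEst n (encodeOrderInstance x n).length γ = orderOf (x : ZMod n) :=
    fun s hs γ hacc => mem_filter.2 ⟨mem_univ _, orderEst_eq (sq_le_qOf x n) hr0 hrn hs hacc⟩
  have hE2 : ∀ γ ∈ univ.filter (fun γ => orderEst n (encodeOrderInstance x n).length γ = orderOf (x : ZMod n)),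
      ∀ ρ : QReg (mW (encodeOrderInstance x n).length),
        List.ofFn (tri (encodeOrderInstance x n).get γ ρ) ∈
          {z | orderFindingPost (boolPair (encodeOrderInstance x n) z) = encodeNat (orderOf (x : ZMod n))} := by
    intro γ hγ ρ
    rw [Set.mem_setOf_eq, orderFindingPost_boolPair, (mem_filter.1 hγ).2]
  have hsucc := kitaev_success (V _) (encodeOrderInstance x n).get R hV hr0 hR' _ hE1
  have hle := sum_tri_le_sum_ite
    ((kitaevCircuit (V _) (typeOf _)).runOn 0
      (basisState (padInput (encodeOrderInstance x n).get (numControls _ + mW _))))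
    (encodeOrderInstance x n).get _ _ hE2
  unfold QCircuitFamily.kernelProb QCircuitFamily.kernel
  change 77 / 96 ≤ ((((kitaevCircuit (V _) (typeOf _)).outputPMF 0 (encodeOrderInstance x n).get).map
    List.ofFn).toOuterMeasure _).toReal
  rw [toReal_outputPMF_map_toOuterMeasure]
  linarith

/-- A kernel gives the sure event probability `1`. [folklore] -/
theorem kernelProb_univ (F : QCircuitFamily cliffordT) (w : List Bool) :
    F.kernelProb 0 w Set.univ = 1 := by
  unfold QCircuitFamily.kernelProb
  rw [((F.kernel 0 w).toOuterMeasure_apply_eq_one_iff Set.univ).2 (Set.subset_univ _),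
    ENNReal.toReal_one]

end Kitaev1995

/-! ### The named facts and the assembly of Shor's order-finding theorem -/

open _root_.Computability Complexity QuantumComplexity Matrix Finset Kitaev1995

/-- **Named fact: Kitaev's order-finding family with a clean modular-exponentiation block is
poly-time uniform** (Shor 1997, §3, p. 8 of arXiv v2: "from results on reversible computation
[Lecerf, Bennett] we can compute any polynomial time function `F(x)` as long as we keep the
input `x` in the computer … once the output `F(x)` has been computed, copy it into a register
that has been preset to zero, and then undo the computation to erase both the first OUTPUT
register and the RECORD register", applied there to modular exponentiation, pp. 9–10; Kitaev
1995, §2.2, Lemma 1: a function computable by a Boolean circuit of size `L` has the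
garbage-free reversible form `(u, 0, 0) ↦ (u, F(u), 0)` in `2L + m` Toffoli-type operations —
exact Clifford+T words by Nielsen–Chuang 2010, §4.3, Fig. 4.9, cf. the tree's `revCompile`;
uniformity: Shor 1997, §2, p. 7, "the design of the gate array be produced by a
polynomial-time (classical) computation", and Kitaev 1995, §4, p. 15, "our procedure is
uniform"). Statement over the tree's model, for the fixed layout `layout ℓ` of this file: there are work-space bounds `mW ℓ` and oracle-free classical blocks
`V ℓ` on `ℓ + numControls ℓ + mW ℓ` wires such that the Kitaev family around them
(`kitaevFamily`) is poly-time uniform, and on every on-promise instance `w = ⟨x, n⟩` (`1 < n`,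
`gcd(x, n) = 1`) the block maps each basis state `|w⟩|y⟩|0^{mW}⟩` to `|w⟩|y⟩|R y⟩` where the
work-register content `R y` determines and is determined by the residues
`x^{A_t(y)} mod n` of the trial exponents `A_t(y) = ∑_{trial j = t} y_j 2^{level j}` (it is the
register holding these `numTrials` modular powers, computed without garbage). This isolates the
programming/uniformity part of the quantum half of Shor's theorem; the quantum analysis is
proved in this file (`Shor1997_orderFinding_isQSolvable_of`).
[cite: Shor1997, §3 p.8 (reversible computation of poly-time F keeping x, erasing garbage) and §2 p.7 (uniformity); Kitaev1995, §2.2 Lemma 1] -/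
def Kitaev1995_orderFindingFamily : Prop :=
  ∃ (mW : ℕ → ℕ) (V : (ℓ : ℕ) → QCircuit cliffordT (ℓ + (numControls ℓ + mW ℓ))),
    (∀ ℓ, (V ℓ).IsOracleFree) ∧ (kitaevFamily mW V).IsUniform ∧
    ∀ x n : ℕ, 1 < n → x.Coprime n →
      ∃ R : QReg (numControls (encodeOrderInstance x n).length) →
          QReg (mW (encodeOrderInstance x n).length),
        (∀ y, (V (encodeOrderInstance x n).length).toMatrix 0 *ᵥ
            basisState (coinInput (encodeOrderInstance x n).get y) =
              basisState (tri (encodeOrderInstance x n).get y (R y))) ∧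
        (∀ y y', R y = R y' ↔ ∀ t,
          x ^ trialExp (trialOf _) (levels _) t y ≡ x ^ trialExp (trialOf _) (levels _) t y' [MOD n])

/-- **Named programming fact: the post-processor is polynomial-time computable** (parse the
pair; for each of the `8 (2ℓ+1)` blocks count the `1`s among `6144 (2ℓ+1)` control bits; table
look-up of the quadrant centre; `2ℓ` halving steps on rationals with denominator `2^{O(ℓ)}`;
the nearest fraction with denominator `< n` by the continued-fraction expansion — Shor 1997,
§5: "this fraction can be found in polynomial time by using a continued fraction expansion";
Kitaev 1995, §3, proof of Thm. 1 — four times; an `lcm`; binary encoding).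
[cite: Shor1997, §5 (continued fractions in polynomial time); Kitaev1995, §3 Thm 1] -/
def orderFindingPost_mem_FP : Prop :=
  orderFindingPost ∈ FP

/-- **The quantum half of Shor's order-finding theorem, from the named facts.** Given the
uniform Kitaev family with its clean modular-exponentiation block
(`Kitaev1995_orderFindingFamily`), the polynomial-time post-processor
(`orderFindingPost_mem_FP`) and classical wrapping inside bounded-error quantum search
(`isQSolvable_classicalWrap`), order finding is solvable in bounded-error quantum polynomial
time (`Shor1997_orderFinding_isQSolvable`): on an on-promise instance the family's control
read-out lands, with probability `≥ 77/96 > 2/3` (`kitaev_success`), in the set of read-outs on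
which the post-processor outputs the order (`orderEst_eq`); off the promise nothing is required.
[cite: Shor1997, §5 (quantum algorithm for order finding); Kitaev1995, §3–§4] -/
theorem Shor1997_orderFinding_isQSolvable_of (hwrap : isQSolvable_classicalWrap)
    (hfam : Kitaev1995_orderFindingFamily) (hpost : orderFindingPost_mem_FP) :
    Shor1997_orderFinding_isQSolvable := by
  classical
  obtain ⟨mW, V, hVfree, hunif, hblock⟩ := hfam
  -- the raw relation solved by the family: "the post-processor outputs the order"
  let R₀ : List Bool → Set (List Bool) := fun w => {z | ∀ x n : ℕ, w = encodeOrderInstance x n →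
    1 < n → x.Coprime n → orderFindingPost (boolPair w z) = encodeNat (orderOf (x : ZMod n))}
  have h0 : IsQSolvable R₀ := by
    refine ⟨kitaevFamily mW V, kitaevFamily_isOracleFree hVfree, hunif, fun w => ?_⟩
    by_cases hw : ∃ x n : ℕ, w = encodeOrderInstance x n ∧ 1 < n ∧ x.Coprime n
    · obtain ⟨x, n, rfl, hn, hx⟩ := hw
      obtain ⟨R, hV, hR⟩ := hblock x n hn hx
      have heq : R₀ (encodeOrderInstance x n) = {z | orderFindingPost
          (boolPair (encodeOrderInstance x n) z) = encodeNat (orderOf (x : ZMod n))} := by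
        ext z
        simp only [Set.mem_setOf_eq, R₀]
        constructor
        · intro h; exact h x n rfl hn hx
        · intro h x' n' hw' hn' hx'
          obtain ⟨rfl, rfl⟩ := encodeOrderInstance_injective hw'
          exact h
      rw [heq]
      have := kernelProb_orderFindingPost_ge x n hn hx R hV hR
      linarith
    · have huniv : R₀ w = Set.univ := by
        ext z
        simp only [Set.mem_univ, iff_true, R₀, Set.mem_setOf_eq]
        intro x n hwxn hn hx
        exact absurd ⟨x, n, hwxn, hn, hx⟩ hw
      rw [huniv, kernelProb_univ]
      norm_num
  -- wrap with the post-processor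
  have h1 := hwrap id orderFindingPost (PolyTimeComputable.id _) hpost h0
  refine h1.mono fun w z' hz' => ?_
  obtain ⟨z, hz, hpre⟩ := hz'
  intro x n hw hn hx
  have hz' : orderFindingPost (boolPair w z) = encodeNat (orderOf (x : ZMod n)) := hz x n hw hn hx
  rw [← hz']
  exact hpre

end Literature.Computability.Cryptography

end
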